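import Summits.BirchSwinnertonDyer.BirchSwinnertonDyer.Theorems.ErratumRoadFiveNonSurjCornerKolyJProp44Manin
import Literature.NumberTheory.EllipticCurves.HeegnerPointsKolyvaginPrimaryEulerProofs
import HarnessLib

/-!
# McCallum 1991, Prop. 4.4 under (irr) — KERNEL ROUTE, step (b2): the EXPLICIT root of `(σ_ℓ − 1)P_{mℓ}` (Gross Prop. 3.6
# with the Euler-system relation), and the reduction bookkeeping that turns Gross Prop. 3.7 (2) into McCallum's
# «`(a_l − (l+1)Frob(l))/p^M · P_m`» — abstract, in the group-ring currency `KolyvaginEuler` of the tree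
# (cell `bsd-stepL`, seat `bsd-stepL-corner-p1` g9; `--supports stmt-BirchSwinnertonDyer-19947`; memo CORNER-G9 §3 (b))

WHAT. In the tree's abstract Euler-system currency (`KolyvaginEuler`: a commutative group `𝒢` acting on `A`, the
group ring `ℤ[𝒢]` through `grAct`, `derivProd σ L = ∏_{ℓ ∈ L} D_ℓ`, `traceElt`, `kolyvaginPoint σ L f y = Σ_q f(q)·D_L y`;
printed `𝒢 = Gal(K_{mℓ}/K)`, `A = E(K_{mℓ})`, `y = y_{mℓ}`, `y' = y_m`):
* §1 `smul_kolyvaginPoint_sub_eq_zsmul` — **the explicit root**: if `σ_ℓ^{ℓ+1} = 1`, `Tr_ℓ y = a·y'` (Prop. 3.7 (1)),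
  `n c₁ = ℓ + 1`, `n c₂ = a`, then `σ_ℓ P − P = n · Q` with **`Q = c₁ · P̂ − c₂ · P'`**, where `P = P_L(y)`,
  `P̂ = P_{L∖ℓ}(y)`, `P' = P_{L∖ℓ}(y')` are Kolyvagin points (Gross's computation in the proof of Prop. 3.6:
  `(σ_ℓ − 1)D_n y_n = (ℓ+1)D_m y_n − D_m Tr_ℓ y_n = D_m((ℓ+1)y_n − a_ℓ y_m)`); `pow_smul_kolyvaginPoint_sub_eq_zsmul` —
  the same for `σ_ℓ^j` with `Q_j = (1 + σ_ℓ + … + σ_ℓ^{j−1})Q`.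
* §2 `map_grAct_eq_of_forall_smul` — **reduction bookkeeping**: for additive `red : A → B` and `F : B → B` with
  `red(γ y) = F(red(γ y'))` for all `γ ∈ 𝒢` (Gross Prop. 3.7 (2) at EVERY prime above `ℓ`: the congruence for all
  conjugates), `red(r·y) = F(red(r·y'))` for every `r ∈ ℤ[𝒢]`; hence `map_kolyvaginPoint_eq_of_forall_smul`:
  `red P̂ = F(red P')`.
* §3 `map_root_eq_transverseValue` — so `red Q = (ℓ+1)·F x − a·x` for ANY `x` with `n·x = red P'` — the
  «transverse value» of `…Prop44Manin`, whose order equals that of `F(F x) − x` by `Prop44.addOrderOf_transverseValue_eq`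
  (step (c)).
What remains NON-abstract for Prop. 4.4: the reduction map `red` on `𝔓`-integral points of `E(K̄)` with
`red ∘ (inertia) = red`, `red ∘ Frob_λ = F² ∘ red` (torsion case: tree `exists_reduceTorsionHom`) and the congruence
Gross Prop. 3.7 (2) as a Literature fact (CORNER-G9 §3 (K1), (F1)). HONEST FRAMING: theorems only, abstract algebra;
no definition ∕ fact ∕ sorry; nothing about any curve; no stub closes; T7.
References: [GrossLMS1991] §3 (3.5), Prop. 3.6 (proof), Prop. 3.7, §4 (4.1); [McCallumLMS1991] §4 proof of Prop. 4.4
(p. 302: «−(σ_l − 1)P_n/p^M ≡ ((a_l − (l+1)Frob(l))/p^M) P_m (mod λ_n)»); [Howard2004HeegnerKolyvagin] Prop. 1.7.4 (arXiv 2.7.4).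
-/

set_option autoImplicit false
set_option linter.dupNamespace false

noncomputable section

open scoped Classical

namespace Summit.BirchSwinnertonDyer.BirchSwinnertonDyer.Theorems.Prop44

open Finset Literature.NumberTheory.EllipticCurves Literature.NumberTheory.EllipticCurves.KolyvaginEuler

variable {𝒢 : Type*} [CommGroup 𝒢] {A : Type*} [AddCommGroup A] [DistribMulAction 𝒢 A]

/-! ### §1 The explicit root of `(σ_ℓ − 1)P` (Gross Prop. 3.6 + Prop. 3.7 (1)) -/

/-- **`(σ_ℓ − 1)D_L y = n · (c₁ D_{L∖ℓ} y − c₂ D_{L∖ℓ} y')`** when `σ_ℓ^{ℓ+1} = 1`, `Tr_ℓ y = a·y'`, `n c₁ = ℓ + 1`,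
`n c₂ = a` (Gross, proof of Prop. 3.6: `(σ_ℓ − 1)D_n = D_m(ℓ + 1 − Tr_ℓ)`). [cite: GrossLMS1991, Prop. 3.6 (proof), Prop. 3.7 (1)] -/
theorem smul_grAct_derivProd_sub_eq_zsmul {σ : ℕ → 𝒢} {L : Finset ℕ} {ℓ : ℕ} (hℓ : ℓ ∈ L)
    (hσ : σ ℓ ^ (ℓ + 1) = 1) {n a c₁ c₂ : ℤ} (hc₁ : n * c₁ = ((ℓ + 1 : ℕ) : ℤ)) (hc₂ : n * c₂ = a)
    {y y' : A} (hrel : grAct A (traceElt (σ ℓ) ℓ) y = a • y') :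
    σ ℓ • grAct A (derivProd σ L) y - grAct A (derivProd σ L) y =
      n • (c₁ • grAct A (derivProd σ (L.erase ℓ)) y - c₂ • grAct A (derivProd σ (L.erase ℓ)) y') := by
  have h1 : σ ℓ • grAct A (derivProd σ L) y - grAct A (derivProd σ L) y =
      grAct A ((MonoidAlgebra.of ℤ 𝒢 (σ ℓ) - 1) * derivProd σ L) y := by
    rw [sub_mul, one_mul, grAct_sub, smul_grAct]
  rw [h1, of_sub_one_mul_derivProd hℓ hσ, grAct_mul, grAct_sub, grAct_natCast, hrel, map_sub, map_nsmul,
    map_zsmul, smul_sub, smul_smul, smul_smul, hc₁, hc₂, natCast_zsmul]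

/-- **The explicit root of `(σ_ℓ − 1)P`** (Gross (4.1), Prop. 3.6, Prop. 3.7 (1); McCallum (4)): for the Kolyvagin point
`P = Σ_q f(q)·D_L y` and `ℓ ∈ L` with `σ_ℓ^{ℓ+1} = 1`, `Tr_ℓ y = a·y'`, `n c₁ = ℓ + 1`, `n c₂ = a`:
`σ_ℓ P − P = n·Q`, **`Q = c₁·P_{L∖ℓ}(y) − c₂·P_{L∖ℓ}(y')`** — in print `Q = Σ_S σ D_m(((ℓ+1)/p^M) y_{mℓ} − (a_ℓ/p^M) y_m)`,
the `K_{mℓ}`-rational `p^M`-th root of `(σ_ℓ − 1)P_{mℓ}` whose reduction McCallum computes (p. 302).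
[cite: GrossLMS1991, §4 (4.1), Prop. 3.6, Prop. 3.7 (1)] [cite: McCallumLMS1991, §4 (4), proof of Prop. 4.4 (p. 302)] -/
theorem smul_kolyvaginPoint_sub_eq_zsmul {σ : ℕ → 𝒢} {L : Finset ℕ} {H : Subgroup 𝒢} [Fintype (𝒢 ⧸ H)]
    (f : 𝒢 ⧸ H → 𝒢) {ℓ : ℕ} (hℓ : ℓ ∈ L) (hσ : σ ℓ ^ (ℓ + 1) = 1) {n a c₁ c₂ : ℤ}
    (hc₁ : n * c₁ = ((ℓ + 1 : ℕ) : ℤ)) (hc₂ : n * c₂ = a) {y y' : A} (hrel : grAct A (traceElt (σ ℓ) ℓ) y = a • y') :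
    σ ℓ • kolyvaginPoint σ L f y - kolyvaginPoint σ L f y =
      n • (c₁ • kolyvaginPoint σ (L.erase ℓ) f y - c₂ • kolyvaginPoint σ (L.erase ℓ) f y') := by
  unfold kolyvaginPoint
  rw [Finset.smul_sum, ← Finset.sum_sub_distrib, Finset.smul_sum, Finset.smul_sum, ← Finset.sum_sub_distrib,
    Finset.smul_sum]
  refine Finset.sum_congr rfl fun q _ ↦ ?_
  rw [smul_comm (σ ℓ) (f q), ← smul_sub, smul_grAct_derivProd_sub_eq_zsmul hℓ hσ hc₁ hc₂ hrel, smul_sub,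
    smul_sub, smul_comm (f q) n, smul_comm (f q) n, smul_comm (f q) c₁, smul_comm (f q) c₂, ← smul_sub]

/-- **Powers**: `σ_ℓ^j P − P = n · (Σ_{i<j} σ_ℓ^i) Q` with the same `Q` (`(σ^j − 1) = (1 + σ + … + σ^{j−1})(σ − 1)`),
for the values of McCallum's cocycle on a decomposition group acting through `⟨σ_ℓ⟩` (`…Prop44Restrict`).
[cite: McCallumLMS1991, §4 proof of Prop. 4.4 (p. 302)] -/
theorem pow_smul_kolyvaginPoint_sub_eq_zsmul {σ : ℕ → 𝒢} {L : Finset ℕ} {H : Subgroup 𝒢} [Fintype (𝒢 ⧸ H)]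
    (f : 𝒢 ⧸ H → 𝒢) {ℓ : ℕ} (hℓ : ℓ ∈ L) (hσ : σ ℓ ^ (ℓ + 1) = 1) {n a c₁ c₂ : ℤ}
    (hc₁ : n * c₁ = ((ℓ + 1 : ℕ) : ℤ)) (hc₂ : n * c₂ = a) {y y' : A} (hrel : grAct A (traceElt (σ ℓ) ℓ) y = a • y')
    (j : ℕ) :
    σ ℓ ^ j • kolyvaginPoint σ L f y - kolyvaginPoint σ L f y =
      n • ∑ i ∈ Finset.range j,
        σ ℓ ^ i • (c₁ • kolyvaginPoint σ (L.erase ℓ) f y - c₂ • kolyvaginPoint σ (L.erase ℓ) f y') := by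
  induction j with
  | zero => simp
  | succ j ih =>
    -- `σ^{j+1} P − P = (σ^j P − P) + σ^j (σP − P)`
    rw [Finset.sum_range_succ, smul_add, ← ih, smul_comm n (σ ℓ ^ j),
      ← smul_kolyvaginPoint_sub_eq_zsmul f hℓ hσ hc₁ hc₂ hrel, smul_sub, pow_succ, mul_smul]
    abel

/-! ### §2 Reduction bookkeeping: `red(r·y) = F(red(r·y'))` from the congruence for all conjugates -/

section Red

variable {B : Type*} [AddCommGroup B]

/-- **From the congruence for every conjugate to every group-ring combination**: if `red(γ y) = F(red(γ y'))` for
all `γ ∈ 𝒢` (Gross Prop. 3.7 (2), «y_n ≡ Frob · y_m (mod λ_n)» at EVERY prime `λ_n ∣ ℓ`, equivalently for every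
conjugate at one prime), then `red(r·y) = F(red(r·y'))` for every `r ∈ ℤ[𝒢]` (`red`, `F` additive).
[cite: GrossLMS1991, Prop. 3.7 (2)] [cite: McCallumLMS1991, §4 proof of Prop. 4.4 (p. 302)] -/
theorem map_grAct_eq_of_forall_smul (red : A →+ B) (F : B →+ B) {y y' : A}
    (hcong : ∀ γ : 𝒢, red (γ • y) = F (red (γ • y'))) (r : MonoidAlgebra ℤ 𝒢) :
    red (grAct A r y) = F (red (grAct A r y')) := by
  induction r using MonoidAlgebra.induction_on with
  | hM g => rw [grAct_of, grAct_of, hcong]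
  | hadd r s hr hs => rw [grAct_add, grAct_add, map_add, hr, hs, map_add, map_add]
  | hsmul c r hr => rw [grAct_smul, grAct_smul, map_zsmul, hr, map_zsmul, map_zsmul]

/-- **Hence for Kolyvagin points**: `red(P_L(y)) = F(red(P_L(y')))` (the coset representatives `f(q) ∈ 𝒢` and `D_L`
are group-ring combinations). [cite: GrossLMS1991, Prop. 3.7 (2), §4 (4.1)] -/
theorem map_kolyvaginPoint_eq_of_forall_smul (red : A →+ B) (F : B →+ B) {y y' : A}
    (hcong : ∀ γ : 𝒢, red (γ • y) = F (red (γ • y'))) (σ : ℕ → 𝒢) (L : Finset ℕ) {H : Subgroup 𝒢}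
    [Fintype (𝒢 ⧸ H)] (f : 𝒢 ⧸ H → 𝒢) :
    red (kolyvaginPoint σ L f y) = F (red (kolyvaginPoint σ L f y')) := by
  unfold kolyvaginPoint
  rw [map_sum, map_sum, map_sum]
  refine Finset.sum_congr rfl fun q _ ↦ ?_
  rw [smul_grAct, smul_grAct, map_grAct_eq_of_forall_smul red F hcong]

/-! ### §3 The reduction of the root is the «transverse value» `(ℓ+1)·F x − a·x` -/

/-- **`red Q = (ℓ+1)·F x − a·x`** for the explicit root `Q = c₁·P_{L∖ℓ}(y) − c₂·P_{L∖ℓ}(y')` of `(σ_ℓ − 1)P` (§1) and ANY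
`x` with `n·x = red(P_{L∖ℓ}(y'))` — McCallum's «`(a_l − (l+1)Frob(l))/p^M · P_m`» (up to the sign convention), given
the congruence for all conjugates (§2). With `…Prop44Manin` (`addOrderOf_transverseValue_eq`) its order is that of
`F(F x) − x`, the reduction of the value `(Frob_λ − 1)(P_m/p^M)` of `c_M(m)` (step (a)) once `red ∘ Frob_λ = F² ∘ red`.
[cite: McCallumLMS1991, §4 proof of Prop. 4.4 (p. 302)] [cite: GrossLMS1991, Prop. 3.7 (2)] -/
theorem map_root_eq_transverseValue (red : A →+ B) (F : B →+ B) {y y' : A}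
    (hcong : ∀ γ : 𝒢, red (γ • y) = F (red (γ • y'))) (σ : ℕ → 𝒢) (L : Finset ℕ) {H : Subgroup 𝒢}
    [Fintype (𝒢 ⧸ H)] (f : 𝒢 ⧸ H → 𝒢) {ℓ : ℕ} {n a c₁ c₂ : ℤ} (hc₁ : n * c₁ = ((ℓ + 1 : ℕ) : ℤ))
    (hc₂ : n * c₂ = a) {x : B} (hx : n • x = red (kolyvaginPoint σ (L.erase ℓ) f y')) :
    red (c₁ • kolyvaginPoint σ (L.erase ℓ) f y - c₂ • kolyvaginPoint σ (L.erase ℓ) f y') =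
      (ℓ + 1 : ℤ) • F x - a • x := by
  rw [map_sub, map_zsmul, map_zsmul, map_kolyvaginPoint_eq_of_forall_smul red F hcong σ (L.erase ℓ) f, ← hx,
    map_zsmul, smul_smul, smul_smul, mul_comm c₁ n, mul_comm c₂ n, hc₁, hc₂]
  push_cast
  rfl

end Red


end Summit.BirchSwinnertonDyer.BirchSwinnertonDyer.Theorems.Prop44

end
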